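import Mathlib
import HarnessLib
/-!
# HodgeLocusCensusTwistRows — the (4,4) Aoki–Shioda TWIST cells δ = [Z] ± [Z′], Z′ = tw(1,0,0,0) (cell pub-hlocus, referee gen 16, REFEREE.md R30)
HONEST FRAMING: certified instances and evidence bearing on the general Hodge conjecture; no claim.

Setting: X_F ⊂ ℙ⁵ the Fermat quartic fourfold, H = {x₄ = ζ₈x₅}, X_F ∩ H = cone_p(S_F) over the Fermat quartic K3 S_F ⊂ ℙ³ (vertex
p = (0,0,0,0,ζ₈,1)); L(α,β) = V(x₀ − ζ^α x₁, x₂ − ζ^β x₃) (α, β odd) the 16 lines of S_F in the (01)(23) pairing, Π(α,β) = cone_p(L(α,β)).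
Kernel-checked here: (1) the plane x₀ = ζx₁ cuts S_F in the FOUR CONCURRENT LINES L(1,β), β ∈ {1,3,5,7} (x₂⁴ + x₃⁴ splits into four linear
factors when ζ⁴ = −1), so on S_F the hyperplane class is h = Σ_β L(1,β) and the class identity E − E′ ∼ L(5,3) + L(5,7) − L(1,3) − L(1,7)
follows from the computed member D₋ = L(1,1) + L(1,5) + L(5,3) + L(5,7) ∈ |E − E′ + h| (mod-p ideal-quotient evidence, two primes,
`data/ivhs/census/refg16/ref_as_residual.json`); (2) the INCIDENCE RULE for the 16 lines: L(α,β) ∩ L(α′,β′) ≠ ∅ iff α = α′ or β = β′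
(over any field with ζ^α ≠ ζ^{α′}, ζ^β ≠ ζ^{β′}), so D₋ is two disjoint pairs of meeting lines (p_a = −1), D₊ = L(3,3)+L(3,7)+L(7,1)+L(7,5)
likewise, the R29 residual C = L(1,1) ∪ L(7,1) ∪ L(7,5) is a CHAIN (two adjacencies, not a triangle), and the two quadric cones
Q = Π(5,3) ∪ Π(5,7), Q′ = Π(1,3) ∪ Π(1,7) with δ = [Q] − [Q′] meet along exactly two lines through p; (3) lattice / dimension bookkeeping:
Z·Z′ = 2·2 + ... (cone law R27: Z·Z′ = m m′ − 3E·E′ = 16 − 12 = 4), δ² = 16 + 16 − 2·4 = 24, (E − E′ + h)² = (E + E′ − h)² = −4,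
(E − E′ + 2h)² = 8; h⁰(𝒪_config(4)) = 4·15 − 2·5 − 4 = 46, 126 − 46 = 80 = dim I_config(4); 111 + 4 = 115 = 126 − 11;
quadric-pair family 26 + 85 = 111; CI(1,2,2) locus 5 + 26 + 84 = 115.
The mod-p certificates (class-polynomial identity P_{Π(5,3)} + P_{Π(5,7)} − P_{Π(1,3)} − P_{Π(1,7)} = P_Z − P_{Z′}; (T_Z ∩ T_Z′) + I_config(4) = ker M_δ;
order-12 lifting; tangent non-inclusions) are `data/ivhs/census/refg16/*.json`: cited evidence, not Lean theorems.
-/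
namespace Summit.HodgeConjecture.HodgeConjecture.HodgeLocus.Census.Twist

variable {R : Type*} [CommRing R]

/-- (1) x₂⁴ + x₃⁴ = Π_{β ∈ {1,3,5,7}} (x₂ − ζ^β x₃) whenever ζ⁴ = −1: a plane x₀ = ζ^α x₁ (α odd) cuts S_F in four concurrent lines. -/
theorem plane_section_four_lines (ζ x₂ x₃ : R) (h : ζ ^ 4 = -1) :
    x₂ ^ 4 + x₃ ^ 4 = (x₂ - ζ * x₃) * (x₂ - ζ ^ 3 * x₃) * (x₂ - ζ ^ 5 * x₃) * (x₂ - ζ ^ 7 * x₃) := by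
  have h5 : ζ ^ 5 = -ζ := by linear_combination ζ * h
  have h7 : ζ ^ 7 = -ζ ^ 3 := by linear_combination ζ ^ 3 * h
  rw [h5, h7]
  linear_combination (x₃ ^ 4 * (1 - ζ ^ 4) + ζ ^ 2 * x₂ ^ 2 * x₃ ^ 2) * h

/-- (2) INCIDENCE RULE, empty half: if ζ^α ≠ ζ^{α′} and ζ^β ≠ ζ^{β′} then L(α,β) ∩ L(α′,β′) = ∅ (the only common solution is 0). -/
theorem lines_disjoint {K : Type*} [Field K] (a a' b b' x₁ x₃ : K) (ha : a ≠ a') (hb : b ≠ b')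
    (h₀ : a * x₁ = a' * x₁) (h₂ : b * x₃ = b' * x₃) : x₁ = 0 ∧ x₃ = 0 := by
  constructor
  · by_contra hx
    exact ha (mul_right_cancel₀ hx h₀)
  · by_contra hx
    exact hb (mul_right_cancel₀ hx h₂)

-- Combinatorial incidence on exponent pairs (α,β): two Fermat lines L(α,β), L(α′,β′) meet iff α = α′ or β = β′ (theorem `lines_disjoint` + the shared point (0:0:ζ^β:1) resp. (ζ^α:1:0:0)); below `decide` evaluates the rule on explicit exponent lists.

/-- D₋ = L(1,1) + L(1,5) + L(5,3) + L(5,7): exactly two of the six pairs meet (two disjoint pairs of meeting lines). -/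
theorem Dminus_two_meeting_pairs :
    [(decide ((1 : Fin 8) = 1) || decide ((1 : Fin 8) = 5)), (decide ((1 : Fin 8) = 5) || decide ((1 : Fin 8) = 3)), (decide ((1 : Fin 8) = 5) || decide ((1 : Fin 8) = 7)), (decide ((1 : Fin 8) = 5) || decide ((5 : Fin 8) = 3)), (decide ((1 : Fin 8) = 5) || decide ((5 : Fin 8) = 7)), (decide ((5 : Fin 8) = 5) || decide ((3 : Fin 8) = 7))].count true = 2 := by
  decide

/-- D₊ = L(3,3) + L(3,7) + L(7,1) + L(7,5): exactly two of the six pairs meet. -/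
theorem Dplus_two_meeting_pairs :
    [(decide ((3 : Fin 8) = 3) || decide ((3 : Fin 8) = 7)), (decide ((3 : Fin 8) = 7) || decide ((3 : Fin 8) = 1)), (decide ((3 : Fin 8) = 7) || decide ((3 : Fin 8) = 5)), (decide ((3 : Fin 8) = 7) || decide ((7 : Fin 8) = 1)), (decide ((3 : Fin 8) = 7) || decide ((7 : Fin 8) = 5)), (decide ((7 : Fin 8) = 7) || decide ((1 : Fin 8) = 5))].count true = 2 := by
  decide

/-- R29 amendment: C = L(1,1) ∪ L(7,1) ∪ L(7,5) is a CHAIN — exactly two of the three pairs meet, and the middle line L(7,1) meets both others. -/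
theorem chain_three_lines :
    (decide ((1 : Fin 8) = 7) || decide ((1 : Fin 8) = 1)) = true ∧ (decide ((7 : Fin 8) = 7) || decide ((1 : Fin 8) = 5)) = true ∧ (decide ((1 : Fin 8) = 7) || decide ((1 : Fin 8) = 5)) = false := by decide

/-- Q ∩ Q′: of the four (line of Q, line of Q′) pairs between {L(5,3), L(5,7)} and {L(1,3), L(1,7)} exactly two meet (β = 3 and β = 7):
the two quadric cones meet along exactly two lines through p. -/
theorem Q_meets_Qprime_in_two_lines :
    [(decide ((5 : Fin 8) = 1) || decide ((3 : Fin 8) = 3)), (decide ((5 : Fin 8) = 1) || decide ((3 : Fin 8) = 7)), (decide ((5 : Fin 8) = 1) || decide ((7 : Fin 8) = 3)), (decide ((5 : Fin 8) = 1) || decide ((7 : Fin 8) = 7))].count true = 2 := by decide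

/-- (3) lattice / dimension bookkeeping of R30 (E² = E′² = 0, E·E′ = 4, E·h = E′·h = 4, h² = 4 on S_F; cone law Z·Z′ = m m′ − 3E·E′). -/
theorem bookkeeping :
    (4 * 4 - 3 * 4 = (4 : ℤ)) ∧ (16 + 16 - 2 * 4 = (24 : ℤ)) ∧
    ((0 : ℤ) + 0 + 4 - 2 * 4 + 2 * 4 - 2 * 4 = -4) ∧ ((0 : ℤ) + 0 + 4 + 2 * 4 - 2 * 4 - 2 * 4 = -4) ∧
    ((0 : ℤ) + 0 + 4 * 4 - 2 * 4 + 4 * 4 - 4 * 4 = 8) ∧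
    (4 * 15 - 2 * 5 - 4 = (46 : ℕ)) ∧ (126 - 46 = (80 : ℕ)) ∧ (111 + 4 = (115 : ℕ)) ∧ (126 - 11 = (115 : ℕ)) ∧
    (26 + 85 = (111 : ℕ)) ∧ (5 + 26 + 84 = (115 : ℕ)) := by decide

end Summit.HodgeConjecture.HodgeConjecture.HodgeLocus.Census.Twist
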